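import Literature.Barriers.RiemannHypothesis.EpsteinZetaRealZerosDHClassSum
import Literature.Barriers.RiemannHypothesis.EpsteinZetaRealZerosDHConj
import Literature.Barriers.RiemannHypothesis.DavenportHeilbronnSeries
import HarnessLib

/-!
# Davenport–Heilbronn for Epstein zeta functions, XI: phase twists — the symmetrised bridge and the
# finite-product factorisation of the twisted class-character series

Sibling of `Literature/Barriers/RiemannHypothesis/EpsteinZetaRealZeros.lean` (named fact
`DavenportHeilbronn1936b_epstein`). Everything in this file is PROVED; no definitions, no named facts.

Davenport–Heilbronn II, §2 and §5: for a completely multiplicative `a` with unimodular prime values,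
"`ζ(s, Q)`" twisted is `(2/h(d)) Σ_χ χ̄(𝔎) M(s, χ)` (I §4, II §2), and by the conjugation symmetry
`M(s, χ̄) = M(s, χ)` (formula (1): `F(s) = ∏_p (1 − p^{-s})^{-2} + 2 Σ_ν ℜχ_ν(𝔎) ∏_p {1 − 2ℜχ_ν(p)
p^{-s} + p^{-2s}}⁻¹`); for "any set of numbers `a(p)` with `|a(p)| = 1`" the twisted function is
(5): `F_a(s) = ∏_p {1 − a(p)p^{-s}}^{-2} + 2 Σ_ν ℜχ_ν(𝔎) ∏_p {1 − 2ℜχ_ν(p) a(p) p^{-s} + a²(p)p^{-2s}}⁻¹`.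
Here, with the tree's `complMul` and phases `a(p) = e^{iθ(p)}`:

* `twistModel_eq_sum_re` — **the symmetrised bridge**
  `Z_a(s) = (2/h) Σ_χ ℜχ([𝔟]) · exp E_χ(s)` (real coefficients), from `twistModel_eq_sum_addChar`
  and `E_{χ̄} = E_χ`;
* `logEuler_twistCoeff_complMul_eq` — **the factorisation**: if `θ(p) = π/2` (i.e. `a(p) = i`)
  outside a finite set `F` of split primes `p = 𝔭_p 𝔭_p'`, then for every `χ` and real `s > 1`
  `E_χ^{a}(s) = E_χ^{i}(s) + Σ_{p∈F} [ℓ(u_p x_p e^{iθ(p)}) + ℓ(u_p⁻¹ x_p e^{iθ(p)}) − ℓ(u_p x_p e^{iπ/2})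
  − ℓ(u_p⁻¹ x_p e^{iπ/2})]`, `ℓ(z) = −log(1 − z)`, `u_p = χ([𝔭_p])`, `x_p = p^{-s}` — the logarithm of
  D–H's local factors `{1 − 2ℜχ(p) a(p) p^{-s} + a²(p) p^{-2s}}⁻¹ = {(1 − χ(𝔭)a(p)p^{-s})(1 − χ̄(𝔭)a(p)p^{-s})}⁻¹`.

## References

* [DavenportHeilbronn1936b] H. Davenport, H. Heilbronn, *On the zeros of certain Dirichlet
  series II*, J. London Math. Soc. 11 (1936), 307–312, §2 (1) and §5 (5).
* [DavenportHeilbronn1936a] — *I*, ibid. 181–185, §4.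
-/

noncomputable section

open Filter Topology Complex Module NumberField Ideal IsDedekindDomain
open Literature.NumberTheory.LFunctions Literature.NumberTheory.LFunctions.AbelianDensity
open Literature.NumberTheory.QuadraticFields.BakerLimitFormula
open Literature.NumberTheory.QuadraticFields.Quadratic
open scoped nonZeroDivisors ComplexConjugate Classical

namespace Literature.Barriers.RiemannHypothesis

namespace DHEpstein

variable {K : Type*} [Field K] [NumberField K]

/-! ## The symmetrised bridge -/

/-- **`Z_a(s) = (2/h) Σ_χ ℜχ([𝔟]) exp E_χ(s)`** for an imaginary quadratic field (`[K:ℚ] = 2`,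
`d_K < −4`): the bridge `twistModel_eq_sum_addChar` averaged with its reindexing `χ ↦ χ̄`, using
`E_{χ̄} = E_χ` (`logEuler_twistCoeff_neg`) and `χ̄([𝔟]) = conj χ([𝔟])` — D–H II's passage from
`Σ_χ χ̄(𝔎) M(s, χ)` to the real-coefficient formula (1)/(5). [cite: DavenportHeilbronn1936b, §2 (1), §5 (5)] -/
theorem twistModel_eq_sum_re (h2 : finrank ℚ K = 2) (b : Basis (Fin 2) ℤ (𝓞 K)) (hb : b 0 = 1)
    {t m : ℤ} (hω : b 1 * b 1 = (m : 𝓞 K) + (t : 𝓞 K) * b 1) (hD : t ^ 2 + 4 * m < -4)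
    {A k C : ℤ} (hA : 0 < A) (hn : A * C = k ^ 2 - t * k - m)
    (a : ℕ →* ℂ) (ha : ∀ n, ‖a n‖ ≤ 1) {s : ℝ} (hs : 1 < s) :
    twistModel a A (t - 2 * k) C (s : ℂ) =
      (2 / (Nat.card (ClassGroup (𝓞 K)) : ℂ)) * ∑ χ : AddChar (Additive (ClassGroup (𝓞 K))) ℂ,
        ((toMulHom χ (idealClass (span {(A : 𝓞 K), b 1 - k}))).re : ℂ) *
          cexp (logEuler (twistCoeff χ a) s) := by
  rw [twistModel_eq_sum_addChar b hb hω hD hA hn a ha hs]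
  congr 1
  set cls : AddChar (Additive (ClassGroup (𝓞 K))) ℂ → ℂ := fun χ ↦
    toMulHom χ (idealClass (span {(A : 𝓞 K), b 1 - k})) with hcls
  set X : AddChar (Additive (ClassGroup (𝓞 K))) ℂ → ℂ := fun χ ↦ cexp (logEuler (twistCoeff χ a) s) with hX
  have hsym : ∑ χ, cls χ * X χ = ∑ χ, conj (cls χ) * X χ := by
    rw [← Equiv.sum_comp (Equiv.neg _) (fun χ ↦ cls χ * X χ)]
    refine Finset.sum_congr rfl fun χ _ ↦ ?_
    simp only [Equiv.neg_apply, hcls, hX]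
    rw [cexp_logEuler_twistCoeff_neg h2 χ a s, conj_toMulHom]
  have hre : ∀ χ, cls χ + conj (cls χ) = 2 * ((cls χ).re : ℂ) := fun χ ↦ by
    rw [Complex.add_conj]; push_cast; ring
  change ∑ χ, cls χ * X χ = ∑ χ, ((cls χ).re : ℂ) * X χ
  calc ∑ χ, cls χ * X χ = (1 / 2) * (∑ χ, cls χ * X χ + ∑ χ, conj (cls χ) * X χ) := by
        rw [← hsym]; ring
    _ = (1 / 2) * ∑ χ, (cls χ + conj (cls χ)) * X χ := by
        rw [← Finset.sum_add_distrib]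
        congr 1
        exact Finset.sum_congr rfl fun χ _ ↦ by ring
    _ = ∑ χ, ((cls χ).re : ℂ) * X χ := by
        rw [Finset.mul_sum]
        exact Finset.sum_congr rfl fun χ _ ↦ by rw [hre]; ring

/-! ## Split primes: the pair of primes above `p` -/

/-- For a split prime `p = 𝔭𝔭'` (`𝔭 ≠ 𝔭'` of norm `p`) of a quadratic field, the primes of norm `p`
are exactly `𝔭, 𝔭'`. [cite: DavenportHeilbronn1936b, §2] -/
theorem primesOfNorm_eq_pair (h2 : finrank ℚ K = 2) {v w : HeightOneSpectrum (𝓞 K)} (hvw : v ≠ w)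
    {p : ℕ} (hv : Ideal.absNorm v.asIdeal = p) (hw : Ideal.absNorm w.asIdeal = p) :
    primesOfNorm K p = {v, w} := by
  ext v'
  rw [mem_primesOfNorm, Finset.mem_insert, Finset.mem_singleton]
  constructor
  · intro hv'
    by_cases h : v' = v
    · exact Or.inl h
    · exact Or.inr (eq_of_ne_of_absNorm_eq h2 h (Ne.symm hvw) (hv'.trans hv.symm) (hw.trans hv.symm))
  · rintro (rfl | rfl)
    · exact hv
    · exact hw

/-- A split prime `p` (`p = 𝔭𝔭'`, `𝔭 ≠ 𝔭'` of norm `p`) has no prime of norm `p²` above it.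
[folklore] -/
theorem absNorm_ne_sq_of_split (h2 : finrank ℚ K = 2) {v w : HeightOneSpectrum (𝓞 K)} (hvw : v ≠ w)
    {p : ℕ} (hp : p.Prime) (hv : Ideal.absNorm v.asIdeal = p) (hw : Ideal.absNorm w.asIdeal = p)
    (v' : HeightOneSpectrum (𝓞 K)) : Ideal.absNorm v'.asIdeal ≠ p ^ 2 := by
  intro h
  -- `v' = (p) = 𝔭𝔭'`, so `𝔭 ∣ v'` and `v' = 𝔭`, of norm `p ≠ p²`
  have hq : underPrime K v' = p := by
    rcases absNorm_eq_or_eq_sq h2 v' with h1 | h1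
    · exfalso
      rw [h] at h1
      have hprime : (p ^ 2).Prime := h1.symm ▸ underPrime_prime K v'
      have := (hprime.pow_eq_iff.mp rfl).2
      omega
    · rw [h] at h1
      exact (Nat.pow_left_injective two_ne_zero h1).symm
  have hsq : Ideal.absNorm v'.asIdeal = underPrime K v' ^ 2 := by rw [hq, h]
  have heq : v'.asIdeal = v.asIdeal * w.asIdeal := by
    rw [asIdeal_eq_span_of_absNorm_eq_sq h2 hsq, hq, mul_eq_span_of_absNorm_eq h2 hvw hp hv hw]
  have hle : v'.asIdeal ≤ v.asIdeal := heq ▸ Ideal.mul_le_right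
  have hmax : v'.asIdeal.IsMaximal := v'.isPrime.isMaximal v'.ne_bot
  have := (hmax.eq_of_le v.isPrime.ne_top hle).symm
  have hN : Ideal.absNorm v'.asIdeal = p := by rw [← this, hv]
  rw [hN] at h
  have h21 := (hp.pow_eq_iff.mp h.symm).2
  omega

/-! ## The factorisation of the twisted class-character series -/

/-- `|complMul (p ↦ e^{iθ(p)}) (n)| ≤ 1`. [folklore] -/
theorem norm_complMul_cexp_le_one (θ : ℕ → ℝ) (n : ℕ) :
    ‖complMul (fun p ↦ cexp (θ p * I)) n‖ ≤ 1 :=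
  norm_complMul_le_one (fun p _ ↦ by rw [Complex.norm_exp_ofReal_mul_I]) n

/-- **Factorisation of `E_χ` for a phase twist differing from `a(p) = i` on a finite set of split
primes** (the logarithm of D–H II's local factors (5)). Let `[K:ℚ] = 2`, `θ : ℕ → ℝ` with
`θ(p) = π/2` for all primes `p ∉ F`, where `F` is a finite set of split primes `p = 𝔭_p𝔭_p'`
(`𝔭_p = V p ≠ 𝔭_p'` of norm `p`). Then for every character `χ` of `Cl(K)` and real `s > 1`,
`E_χ(a_θ, s) = E_χ(a_{π/2}, s) + Σ_{p∈F} [ℓ(u e^{iθ(p)}) + ℓ(u⁻¹ e^{iθ(p)}) − ℓ(u e^{iπ/2}) − ℓ(u⁻¹ e^{iπ/2})]`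
with `ℓ(β) = −log(1 − χ([𝔭_p]) p^{-s} β)` written as `−log(1 − u · x · β)`, `u = χ([𝔭_p])`,
`x = p^{-s}`, where `a_θ = complMul (p ↦ e^{iθ(p)})`. (Only the primes above `p ∈ F` see the change
of `a`; they are `𝔭_p` and `𝔭_p'`, with `[𝔭_p'] = [𝔭_p]⁻¹`.) [cite: DavenportHeilbronn1936b, §5 (5)] -/
theorem logEuler_twistCoeff_complMul_eq (h2 : finrank ℚ K = 2)
    (χ : AddChar (Additive (ClassGroup (𝓞 K))) ℂ) (θ : ℕ → ℝ) (F : Finset ℕ)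
    (V : ℕ → HeightOneSpectrum (𝓞 K))
    (hF : ∀ p ∈ F, p.Prime ∧ Ideal.absNorm (V p).asIdeal = p ∧
      ∃ w : HeightOneSpectrum (𝓞 K), w ≠ V p ∧ Ideal.absNorm w.asIdeal = p)
    (hθ : ∀ p : ℕ, p.Prime → p ∉ F → θ p = Real.pi / 2) {s : ℝ} (hs : 1 < s) :
    logEuler (twistCoeff χ (complMul fun p ↦ cexp (θ p * I))) s =
      logEuler (twistCoeff χ (complMul fun _ ↦ cexp ((Real.pi / 2 : ℝ) * I))) s +
      ∑ p ∈ F, (-Complex.log (1 - toMulHom χ (primeClass (V p)) * ((p : ℝ) ^ (-s) : ℝ) * cexp (θ p * I)) +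
        -Complex.log (1 - (toMulHom χ (primeClass (V p)))⁻¹ * ((p : ℝ) ^ (-s) : ℝ) * cexp (θ p * I)) -
        -Complex.log (1 - toMulHom χ (primeClass (V p)) * ((p : ℝ) ^ (-s) : ℝ) *
          cexp ((Real.pi / 2 : ℝ) * I)) -
        -Complex.log (1 - (toMulHom χ (primeClass (V p)))⁻¹ * ((p : ℝ) ^ (-s) : ℝ) *
          cexp ((Real.pi / 2 : ℝ) * I))) := by
  set g : ℕ → ℂ := fun p ↦ cexp (θ p * I) with hg
  set g₀ : ℕ → ℂ := fun _ ↦ cexp ((Real.pi / 2 : ℝ) * I) with hg₀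
  set a : ℕ → ℂ := ⇑(complMul g) with ha
  set a₀ : ℕ → ℂ := ⇑(complMul g₀) with ha₀
  have hna : ∀ n, ‖a n‖ ≤ 1 := norm_complMul_cexp_le_one θ
  have hna₀ : ∀ n, ‖a₀ n‖ ≤ 1 := norm_complMul_cexp_le_one (fun _ ↦ Real.pi / 2)
  have hta : ∀ v, ‖twistCoeff χ a v‖ ≤ 1 := norm_twistCoeff_le χ hna
  have hta₀ : ∀ v, ‖twistCoeff χ a₀ v‖ ≤ 1 := norm_twistCoeff_le χ hna₀
  -- the partner prime and the pair structure
  haveI : Nonempty (HeightOneSpectrum (𝓞 K)) := by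
    obtain ⟨M, hM⟩ := Ideal.exists_maximal (𝓞 K)
    exact ⟨⟨M, hM.isPrime, Ring.ne_bot_of_isMaximal_of_not_isField hM (RingOfIntegers.not_isField K)⟩⟩
  choose! W hW using fun p (hp : p ∈ F) ↦ (hF p hp).2.2
  have hVN : ∀ p ∈ F, Ideal.absNorm (V p).asIdeal = p := fun p hp ↦ (hF p hp).2.1
  have hWN : ∀ p ∈ F, Ideal.absNorm (W p).asIdeal = p := fun p hp ↦ (hW p hp).2
  have hVW : ∀ p ∈ F, V p ≠ W p := fun p hp ↦ (hW p hp).1.symm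
  have hFp : ∀ p ∈ F, p.Prime := fun p hp ↦ (hF p hp).1
  have hpair : ∀ p ∈ F, primesOfNorm K p = {V p, W p} := fun p hp ↦
    primesOfNorm_eq_pair h2 (hVW p hp) (hVN p hp) (hWN p hp)
  have hWcls : ∀ p ∈ F, primeClass (W p) = (primeClass (V p))⁻¹ := fun p hp ↦
    eq_inv_of_mul_eq_one_right (primeClass_mul_primeClass_eq_one h2 (hVW p hp) (hFp p hp) (hVN p hp) (hWN p hp))
  -- the support of the difference
  set VF : Finset (HeightOneSpectrum (𝓞 K)) := F.biUnion fun p ↦ primesOfNorm K p with hVF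
  -- `a (N v) = a₀ (N v)` off `VF`
  have hoff : ∀ v ∉ VF, a (Ideal.absNorm v.asIdeal) = a₀ (Ideal.absNorm v.asIdeal) := by
    intro v hv
    obtain ⟨f, hf0, hf⟩ := absNorm_eq_underPrime_pow K v
    set q := underPrime K v with hq
    have hqp : q.Prime := underPrime_prime K v
    have hqF : q ∉ F := by
      intro hqF
      rcases absNorm_eq_or_eq_sq h2 v with h1 | h1
      · exact hv (Finset.mem_biUnion.2 ⟨q, hqF, mem_primesOfNorm.2 h1⟩)
      · exact absNorm_ne_sq_of_split h2 (hVW q hqF) hqp (hVN q hqF) (hWN q hqF) v h1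
    rw [hf, ha, ha₀, complMul_prime_pow g hqp, complMul_prime_pow g₀ hqp, hg, hg₀]
    simp only [hθ q hqp hqF]
  have hterm_off : ∀ v ∉ VF, logEulerTerm (twistCoeff χ a) s v - logEulerTerm (twistCoeff χ a₀) s v = 0 := by
    intro v hv
    unfold logEulerTerm zterm twistCoeff
    rw [hoff v hv, sub_self]
  -- the difference as a finite sum
  have hsum_a := summable_logEulerTerm hta hs
  have hsum_a₀ := summable_logEulerTerm hta₀ hs
  have hdiff : logEuler (twistCoeff χ a) s - logEuler (twistCoeff χ a₀) s =
      ∑ v ∈ VF, (logEulerTerm (twistCoeff χ a) s v - logEulerTerm (twistCoeff χ a₀) s v) := by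
    unfold logEuler
    rw [← hsum_a.tsum_sub hsum_a₀, tsum_eq_sum (s := VF) (fun v hv ↦ hterm_off v hv)]
  -- regroup over `p ∈ F`
  have hdisj : (F : Set ℕ).PairwiseDisjoint fun p ↦ primesOfNorm K p := by
    intro p _ p' _ hpp'
    rw [Function.onFun, Finset.disjoint_left]
    intro v hv hv'
    rw [mem_primesOfNorm] at hv hv'
    exact hpp' (hv.symm.trans hv')
  rw [← sub_eq_iff_eq_add', hdiff, hVF, Finset.sum_biUnion hdisj]
  refine Finset.sum_congr rfl fun p hp ↦ ?_
  rw [hpair p hp, Finset.sum_pair (hVW p hp)]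
  -- the two terms
  have hx : ∀ {v : HeightOneSpectrum (𝓞 K)}, Ideal.absNorm v.asIdeal = p → (npow v s : ℂ) = (((p : ℝ) ^ (-s) : ℝ) : ℂ) := by
    intro v hv; unfold npow; rw [hv]
  have haV : a (Ideal.absNorm (V p).asIdeal) = cexp (θ p * I) := by
    rw [hVN p hp, ha, complMul_prime g (hFp p hp)]
  have haW : a (Ideal.absNorm (W p).asIdeal) = cexp (θ p * I) := by
    rw [hWN p hp, ha, complMul_prime g (hFp p hp)]
  have ha₀V : a₀ (Ideal.absNorm (V p).asIdeal) = cexp ((Real.pi / 2 : ℝ) * I) := by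
    rw [hVN p hp, ha₀, complMul_prime g₀ (hFp p hp)]
  have ha₀W : a₀ (Ideal.absNorm (W p).asIdeal) = cexp ((Real.pi / 2 : ℝ) * I) := by
    rw [hWN p hp, ha₀, complMul_prime g₀ (hFp p hp)]
  unfold logEulerTerm zterm twistCoeff
  rw [haV, haW, ha₀V, ha₀W, hx (hVN p hp), hx (hWN p hp), hWcls p hp, map_inv]
  ring_nf

end DHEpstein

end Literature.Barriers.RiemannHypothesis
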